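import Summits.ResolutionOfSingularities.ResolutionOfSingularities.Theorems.MarkedTransferCampaignW46LiteralCentreProcrastination
import Literature.AlgebraicGeometry.Resolution.MarkedIdeals
import Mathlib.AlgebraicGeometry.Morphisms.Smooth
import Mathlib.RingTheory.RingHom.Smooth
import Mathlib.RingTheory.KrullDimension.Polynomial
import Mathlib.RingTheory.KrullDimension.Field
import Mathlib.RingTheory.Jacobson.Ring
import Mathlib.RingTheory.Spectrum.Prime.RingHom
import HarnessLib

/-!
# [OURS · L1 W4.6 rung (i), negative half — the initial state] The affine plane with the exponent `(y·𝒪, 1)`: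
# a standard ideal exponent of dimension `2` with infinite singular locus
# (cell res-hironaka, LADDER-RESOLUTION rung L, D-0089; campaign s46, prover res-L1-s46-pv-1; host route
# MarkedTransfer, `--supports stmt-ResolutionOfSingularities-16155`)

HONEST FRAMING. Nothing here is a statement of H. Hironaka's manuscript (2017-03-23, [Hironaka2017]). This file
supplies the EXPLICIT initial state required by the procrastination theorem
`CampaignW46.not_terminates_dimLE_of_resumesCover` (companion module
`MarkedTransferCampaignW46LiteralCentreProcrastination`): the ambient datum `Spec K[x₀, x₁] → Spec K` (row 001
`AmbientDatum`, any field `K` of characteristic `p`) and on it the ideal exponent `E₀ = (𝓘, 1)` with `𝓘` the reduced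
ideal of the line `{x₁ = 0}`; we PROVE `E₀` is standard, `dim Spec K[x₀, x₁] ≤ 2`, and `Sing(E₀) = {x₁ = 0}` is
infinite (it contains the pull-backs of the infinitely many primes of `K[t]` — a Jacobson domain that is not a
field has infinitely many maximal ideals). Elementary commutative algebra over Mathlib; AI review is weaker than
expert review. No `sorry`; axioms standard.

## Contents

* `infinite_primeSpectrum_of_isJacobsonRing` — a Jacobson domain which is not a field has infinitely many primes;
  `infinite_primeSpectrum_polynomial` — `Spec K[t]` is infinite for every field `K`.
* `planeRing K = MvPolynomial (Fin 2) K`; `planeAmbientDatum p K : AmbientDatum p K` (`Spec K[x₀,x₁] → Spec K`).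
* `planeLine K` — the closed set `{x₁ = 0}`; `planeLineExponent p K = (𝓘_{x₁ = 0}, 1)`.
* `planeLineExponent_isStandard`, `planeLine_infinite`, `planeLineExponent_sing_infinite`,
  `planeAmbientDatum_dimLE_two`.
* `not_terminates_dimLE_of_resumesCover_plane` — **for every notion instance `N`, reading `Rd` and `d ≥ 2` over a
  perfect field: coverage of the standard states with infinite singular locus in dimension `≤ d` by résumés ALONE
  refutes `Terminates N Rd (Regime.dimLE d)`** (the initial state is the plane with `(𝓘_{x₁=0}, 1)`).

## References

* companion modules `MarkedTransferCampaignW46LiteralCentreProcrastination` (the engine and the theorem),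
  `MarkedTransferCampaignW46TypedProcedure` (res-L1-type-o1). H. Hironaka, ms. 2017-03-23, Th. 16.6 p.84 l.4–6 —
  scope only, under adjudication, not cited as fact. [Hironaka2017]
-/

noncomputable section

set_option linter.dupNamespace false -- mandated namespace of this single-conjunct summit

open CategoryTheory AlgebraicGeometry TopologicalSpace

namespace Summit.ResolutionOfSingularities.ResolutionOfSingularities.Theorems

namespace CampaignW46

open Literature.AlgebraicGeometry.Resolution
open Literature.AlgebraicGeometry.Hironaka2017.S02Preliminaries
open Scheme.IdealSheafData

universe u

/-! ## Infinitely many primes -/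

/-- A Jacobson domain which is not a field has infinitely many prime ideals: were they finitely many, the
(finitely many, non-zero) maximal ideals would have non-zero product inside their intersection, which is the
Jacobson radical of `0`, i.e. `0`. [folklore] -/
theorem infinite_primeSpectrum_of_isJacobsonRing (R : Type*) [CommRing R] [IsDomain R] [IsJacobsonRing R]
    (hR : ¬ IsField R) : Infinite (PrimeSpectrum R) := by
  classical
  by_contra hfin
  rw [not_infinite_iff_finite] at hfin
  -- the maximal ideals form a finite set
  set M : Set (Ideal R) := {m | m.IsMaximal} with hM
  have hMfin : M.Finite := by
    refine (Set.finite_range fun x : PrimeSpectrum R => x.asIdeal).subset ?_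
    intro m hm
    exact ⟨⟨m, hm.isPrime⟩, rfl⟩
  -- Jacobson: their intersection is `0`
  have hjac : sInf M = (⊥ : Ideal R) := by
    have h := IsJacobsonRing.out' (R := R) ⊥ Ideal.isRadical_bot_of_noZeroDivisors
    rw [Ideal.jacobson] at h
    have hset : {J : Ideal R | ⊥ ≤ J ∧ J.IsMaximal} = M := by
      ext J; simp [hM]
    rw [hset] at h
    exact h
  -- hence the product of the maximal ideals is `0`, so one of them is `0`
  have hprod : ∏ m ∈ hMfin.toFinset, m = (⊥ : Ideal R) := by
    refine le_bot_iff.1 ?_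
    calc ∏ m ∈ hMfin.toFinset, m ≤ hMfin.toFinset.inf id := Ideal.prod_le_inf
      _ = sInf (hMfin.toFinset : Set (Ideal R)) := Finset.inf_id_eq_sInf _
      _ = sInf M := by rw [Set.Finite.coe_toFinset]
      _ = ⊥ := hjac
  obtain ⟨m, hm, hm0⟩ := Finset.prod_eq_zero_iff.1 hprod
  rw [Set.Finite.mem_toFinset] at hm
  -- a maximal ideal equal to `0` makes `R` a field
  apply hR
  have hmax : (⊥ : Ideal R).IsMaximal := by
    have hm' : m.IsMaximal := hm
    rwa [hm0] at hm'
  haveI : IsSimpleOrder (Ideal R) := isSimpleOrder_iff_isCoatom_bot.2 (Ideal.isMaximal_def.1 hmax)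
  exact Ring.isField_iff_isSimpleOrder_ideal.2 this

/-- `Spec K[t]` is infinite for every field `K`. [folklore] -/
theorem infinite_primeSpectrum_polynomial (K : Type*) [Field K] : Infinite (PrimeSpectrum (Polynomial K)) :=
  infinite_primeSpectrum_of_isJacobsonRing (Polynomial K) (Polynomial.not_isField K)

/-! ## The affine plane as an ambient datum -/

/-- [OURS] The coordinate ring `K[x₀, x₁]` of the affine plane. [folklore] -/
abbrev planeRing (K : Type u) [Field K] : Type u := MvPolynomial (Fin 2) K

variable (p : ℕ) [Fact p.Prime] (K : Type u) [Field K] [CharP K p]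

/-- `Spec K[x₀, x₁] → Spec K` is smooth (a polynomial algebra is smooth). [folklore] -/
theorem smooth_specPlane :
    Smooth (Spec.map (CommRingCat.ofHom (algebraMap K (planeRing K)))) := by
  rw [HasRingHomProperty.Spec_iff (P := @Smooth)]
  have : Algebra.Smooth K (planeRing K) := {}
  exact RingHom.smooth_algebraMap.mpr this

/-- [OURS · L1 W4.6] NOT a statement of the manuscript. The affine plane `Spec K[x₀, x₁] → Spec K` as a row-001
ambient datum (irreducible: spectrum of a domain; smooth: polynomial algebra; quasi-compact: affine). [folklore] -/
def planeAmbientDatum : AmbientDatum p K where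
  Z := Spec (.of (planeRing K))
  hom := Spec.map (CommRingCat.ofHom (algebraMap K (planeRing K)))
  irreducible := inferInstanceAs (IrreducibleSpace (PrimeSpectrum (planeRing K)))
  smooth := smooth_specPlane K
  quasiCompact := inferInstance

/-- `dim Spec K[x₀, x₁] ≤ 2`. [folklore] -/
theorem planeAmbientDatum_dimLE_two : topologicalKrullDim (planeAmbientDatum p K).Z ≤ ((2 : ℕ) : WithBot ℕ∞) := by
  show topologicalKrullDim (PrimeSpectrum (MvPolynomial (Fin 2) K)) ≤ _
  rw [PrimeSpectrum.topologicalKrullDim_eq_ringKrullDim,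
    MvPolynomial.ringKrullDim_of_isNoetherianRing, ringKrullDim_eq_zero_of_field, zero_add]
  simp

/-! ## The line `{x₁ = 0}` and the exponent `(𝓘_{x₁ = 0}, 1)` -/

/-- [OURS] The closed set `{x₁ = 0} ⊆ Spec K[x₀, x₁]` (primes containing `x₁`). [folklore] -/
def planeLine : Closeds (planeAmbientDatum p K).Z :=
  ⟨(PrimeSpectrum.zeroLocus {MvPolynomial.X 1} : Set (PrimeSpectrum (planeRing K))),
    PrimeSpectrum.isClosed_zeroLocus _⟩

/-- [OURS · L1 W4.6] NOT a statement of the manuscript. The ideal exponent `E₀ = (𝓘, 1)` on the plane, `𝓘` the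
reduced ideal sheaf of the line `{x₁ = 0}`. [folklore] -/
def planeLineExponent : IdealExponent (planeAmbientDatum p K).Z :=
  ⟨vanishingIdeal (planeLine p K), 1⟩

/-- The substitution `x₀ ↦ t`, `x₁ ↦ 0`: `K[x₀, x₁] → K[t]`. [folklore] -/
def toLine : planeRing K →ₐ[K] Polynomial K :=
  MvPolynomial.aeval ![Polynomial.X, 0]

/-- The substitution kills `x₁`. [folklore] -/
theorem toLine_X_one : toLine K (MvPolynomial.X 1) = 0 := by
  simp [toLine]

/-- The substitution is surjective (`t ↦ x₀` is a section). [folklore] -/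
theorem toLine_surjective : Function.Surjective (toLine K) := by
  intro g
  refine ⟨Polynomial.aeval (MvPolynomial.X 0 : planeRing K) g, ?_⟩
  rw [toLine, ← Polynomial.aeval_algHom_apply]
  simp

/-- The line `{x₁ = 0}` has infinitely many points: it contains the (distinct) pull-backs of the primes of `K[t]`
along the surjection `x₀ ↦ t, x₁ ↦ 0`. [folklore] -/
theorem planeLine_infinite : (planeLine p K : Set (planeAmbientDatum p K).Z).Infinite := by
  haveI := infinite_primeSpectrum_polynomial K
  have hinj : Function.Injective (PrimeSpectrum.comap (toLine K).toRingHom) :=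
    PrimeSpectrum.comap_injective_of_surjective _ (toLine_surjective K)
  have hrange : Set.range (PrimeSpectrum.comap (toLine K).toRingHom) ⊆
      (planeLine p K : Set (planeAmbientDatum p K).Z) := by
    rintro _ ⟨q, rfl⟩
    show PrimeSpectrum.comap (toLine K).toRingHom q ∈ PrimeSpectrum.zeroLocus {MvPolynomial.X 1}
    rw [PrimeSpectrum.mem_zeroLocus, Set.singleton_subset_iff]
    show (MvPolynomial.X 1 : planeRing K) ∈ Ideal.comap (toLine K).toRingHom q.asIdeal
    rw [Ideal.mem_comap]
    simp [toLine_X_one]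
  exact (Set.infinite_range_of_injective hinj).mono hrange

/-- The line is not the whole plane (the generic point `(0)` is not on it). [folklore] -/
theorem planeLine_ne_univ : (planeLine p K : Set (planeAmbientDatum p K).Z) ≠ Set.univ := by
  intro h
  have hmem : (⟨⊥, Ideal.isPrime_bot⟩ : PrimeSpectrum (planeRing K)) ∈
      (PrimeSpectrum.zeroLocus {MvPolynomial.X 1} : Set (PrimeSpectrum (planeRing K))) := by
    have : (⟨⊥, Ideal.isPrime_bot⟩ : PrimeSpectrum (planeRing K)) ∈
        (planeLine p K : Set (planeAmbientDatum p K).Z) := h ▸ Set.mem_univ _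
    exact this
  rw [PrimeSpectrum.mem_zeroLocus, Set.singleton_subset_iff] at hmem
  exact MvPolynomial.X_ne_zero (1 : Fin 2) ((Ideal.mem_bot).1 hmem)

/-- `E₀` is standard: `𝓘 ≠ 0` and `b = 1 > 0`. [folklore] -/
theorem planeLineExponent_isStandard : (planeLineExponent p K).IsStandard := by
  refine ⟨fun h => planeLine_ne_univ p K ?_, Nat.one_pos⟩
  -- `supp 𝓘 = line`; with `𝓘 = ⊥` the support is everything
  have h' : vanishingIdeal (planeLine p K) = ⊥ := h
  rw [← coe_support_vanishingIdeal (planeLine p K), h', support_bot]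
  rfl

/-- `Sing(E₀) = {x₁ = 0}` is infinite (multiplicity one: the singular locus is the support of `𝓘`). [folklore] -/
theorem planeLineExponent_sing_infinite : (planeLineExponent p K).sing.Infinite := by
  have hs : (planeLineExponent p K).sing =
      ((vanishingIdeal (planeLine p K)).support : Set (planeAmbientDatum p K).Z) :=
    MarkedIdeal.support_of_mult_eq_one
      (⟨vanishingIdeal (planeLine p K), [], 1⟩ : MarkedIdeal (planeAmbientDatum p K).Z) rfl
  rw [hs, coe_support_vanishingIdeal]
  exact planeLine_infinite p K

/-! ## The procrastination theorem with its initial state supplied -/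

/-- **Procrastination, unconditional but for coverage.** [OURS · L1 W4.6] NOT a statement of the manuscript. Over a
perfect field `K` of characteristic `p`, for EVERY notion instance `N`, EVERY reading `Rd` and every `d ≥ 2`: if the
typed procedure has a résumé for every standard ideal exponent with infinite singular locus on ambient data of
dimension `≤ d`, then the typed Th. 16.6 procedure with the LITERAL centre rule does not terminate in the regime
`dimLE d` — starting from the plane with `(𝓘_{x₁=0}, 1)` and blowing up closed points of `∇` forever. [folklore] -/
theorem not_terminates_dimLE_of_resumesCover_plane [PerfectField K] {n : ℕ} (N : Notions.{u} n)
    (Rd : Reading p K N) {d : ℕ} (hd : 2 ≤ d)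
    (hcov : ResumesCover N Rd fun A E =>
      topologicalKrullDim A.Z ≤ (d : WithBot ℕ∞) ∧ E.IsStandard ∧ E.sing.Infinite) :
    ¬ Terminates N Rd (Regime.dimLE d) := by
  have h₀d : topologicalKrullDim (planeAmbientDatum p K).Z ≤ (d : WithBot ℕ∞) :=
    (planeAmbientDatum_dimLE_two p K).trans (by exact_mod_cast hd)
  exact not_terminates_dimLE_of_resumesCover N Rd d hcov h₀d (planeLineExponent_isStandard p K)
    (planeLineExponent_sing_infinite p K)

/-- The same for the unrestricted regime. [folklore] -/
theorem not_terminates_top_of_resumesCover_plane [PerfectField K] {n : ℕ} (N : Notions.{u} n)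
    (Rd : Reading p K N) {d : ℕ} (hd : 2 ≤ d)
    (hcov : ResumesCover N Rd fun A E =>
      topologicalKrullDim A.Z ≤ (d : WithBot ℕ∞) ∧ E.IsStandard ∧ E.sing.Infinite) :
    ¬ Terminates N Rd Regime.top :=
  fun hT => not_terminates_dimLE_of_resumesCover_plane p K N Rd hd hcov
    (terminates_antitone (fun _ _ _ => trivial) hT)

end CampaignW46

end Summit.ResolutionOfSingularities.ResolutionOfSingularities.Theorems

end
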